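import Mathlib
import Literature.NumberTheory.LFunctions.Zhang2022.Section4GaussianWeight
import HarnessLib

/-!
# Zhang (2022), Appendix B, proof of (B.3): the cut-off weight `ϰ₁` versus the Gaussian-smoothed weight

Topic `Literature/NumberTheory/LFunctions/Zhang2022` (Landau–Siegel audit tree; verdict-neutral).
Y. Zhang, *Discrete mean estimates and the Landau–Siegel zero*, arXiv:2211.02515v1 (2022)
[Zhang2022LandauSiegel] — **an unrefereed manuscript under adjudication**. Appendix B, p. 108
(tex L5322, DAG `Z22:§B.u013`): "By (4.2) and (4.3), the left side of (B.3) is equal to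
`Σ_l ϱ_j(l)/l (P₁/(l₁l))^{β₆} (1/0.504)∫_{0.5}^{0.504} {g(P^z/(l₁l)) − g(P^{0.5}/(l₁l))} dz + O(α₁)`."
The mechanism: for `y = l₁l`, `(1/0.504)∫_{0.5}^{0.504} (1[y < P^z] − 1[y < P^{1/2}]) dz` IS the
amplitude `(1 − log y/log P₁)·1[P^{1/2} < y < P₁]` of `ϰ₁(y)` on the tail (`P₁ = P^{0.504}`), and the
Gaussian weight `g` of (4.1) differs from the indicator `1[x > 1]` by `≤ ½e^{−Λ log²x}` ((4.2), (4.3), the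
tree's `GaussWeight.abs_gWeight_sub_one_le` / `gWeight_le`). This file PROVES the weight-level facts
(generic smoothing parameter `Λ > 0`, level `P > 1`, point `y > 0`):

* `abs_gWeight_sub_indicator_le` — `|g(x) − 1[x>1]| ≤ ½e^{−Λ log²x}` for all `x > 0`;
* `integral_indicator_eq` — `∫_{0.5}^{0.504} 1[log y/log P < z] dz = (0.504 − max(0.5, log y/log P))₊`;
* `abs_weight_transition_le` — `|∫_{0.5}^{0.504}(g(P^z/y) − g(P^{0.5}/y))dz − (∫ 1[y<P^z] − 0.004·1[y<P^{0.5}])|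
  ≤ ∫_{0.5}^{0.504} ½e^{−Λ(z log P − log y)²}dz + 0.004·½e^{−Λ(0.5 log P − log y)²}`;
* `integral_gauss_transition_le` — `∫_{0.5}^{0.504} ½e^{−Λ(zL − c)²}dz ≤ ½√(π/Λ)/L`;
* `gauss_transition_decay` — for `log y ≥ L ≥ 1`, `Λ ≥ 9`, `z ≤ 0.504`: `½e^{−Λ(zL − log y)²} ≤ ½y⁻²`.

The source-level estimate `Z22:§B.u013` is assembled from these in a companion file. No claim about
Lemma 15.1, Theorems 1–2 of the source or about Landau–Siegel zeros is made.
-/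

noncomputable section

open Real Set MeasureTheory

namespace Literature.NumberTheory.LFunctions.Zhang2022.AppendixBVarrho

open Literature.NumberTheory.LFunctions.Zhang2022 GaussWeight

/-! ## `g` versus the indicator -/

/-- **(4.2)–(4.3) combined**: `|g(x) − 1[x > 1]| ≤ ½e^{−Λ log²x}` for every `x > 0`.
[cite: Zhang2022LandauSiegel, §4 (4.2)–(4.3)] -/
theorem abs_gWeight_sub_indicator_le {Λ x : ℝ} (hΛ : 0 < Λ) (hx : 0 < x) :
    |gWeight Λ x - (if 1 < x then 1 else 0)| ≤ (1 / 2) * rexp (-Λ * (Real.log x) ^ 2) := by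
  split_ifs with h
  · exact abs_gWeight_sub_one_le hΛ h.le
  · rw [sub_zero, abs_of_pos (gWeight_pos hΛ x)]
    exact gWeight_le hΛ hx (not_lt.mp h)

/-- `P^z/y > 1 ⟺ log y/log P < z` (`P > 1`, `y > 0`). [folklore] -/
private theorem one_lt_rpow_div_iff {P y z : ℝ} (hP : 1 < P) (hy : 0 < y) :
    1 < P ^ z / y ↔ Real.log y / Real.log P < z := by
  have hP0 : 0 < P := by linarith
  have hlogP : 0 < Real.log P := Real.log_pos hP
  rw [one_lt_div hy, div_lt_iff₀ hlogP, ← Real.log_rpow hP0, Real.log_lt_log_iff hy (Real.rpow_pos_of_pos hP0 z)]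

/-- `log(P^z/y) = z log P − log y`. [folklore] -/
private theorem log_rpow_div {P y : ℝ} (hP : 0 < P) (hy : 0 < y) (z : ℝ) :
    Real.log (P ^ z / y) = z * Real.log P - Real.log y := by
  rw [Real.log_div (Real.rpow_pos_of_pos hP z).ne' hy.ne', Real.log_rpow hP]

/-! ## The indicator weight integrates to the amplitude of `ϰ₁` -/

/-- `∫_{0.5}^{0.504} 1[u < z] dz = (0.504 − max(0.5, u))₊` — with `u = log y/log P` this is `0.504·` the
amplitude of `ϰ₁` on the tail of (B.3) ((8.6), (15.1)). [cite: Zhang2022LandauSiegel, App. B p.108 (proof of (B.3)); §8 (8.6)] -/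
theorem integral_indicator_eq (u : ℝ) :
    ∫ z in (0.5 : ℝ)..0.504, (Ioi u).indicator (fun _ => (1 : ℝ)) z =
      max (0.504 - max 0.5 u) 0 := by
  rw [intervalIntegral.integral_of_le (by norm_num : (0.5 : ℝ) ≤ 0.504),
    integral_indicator measurableSet_Ioi, Measure.restrict_restrict measurableSet_Ioi,
    Set.inter_comm, Set.Ioc_inter_Ioi, setIntegral_const, smul_eq_mul, mul_one, measureReal_def,
    Real.volume_Ioc, ENNReal.toReal_ofReal']

/-! ## The transition bound -/

/-- **The weight transition**: for `Λ > 0`, `P > 1`, `y > 0`,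
`|∫_{0.5}^{0.504}(g(P^z/y) − g(P^{0.5}/y))dz − (∫_{0.5}^{0.504} 1[log y/log P < z]dz − 0.004·1[y < P^{0.5}])|`
`≤ ∫_{0.5}^{0.504} ½e^{−Λ(z log P − log y)²}dz + 0.004·½e^{−Λ(0.5 log P − log y)²}` (pointwise (4.2)/(4.3)).
[cite: Zhang2022LandauSiegel, App. B p.108; §4 (4.2)–(4.3)] -/
theorem abs_weight_transition_le {Λ P y : ℝ} (hΛ : 0 < Λ) (hP : 1 < P) (hy : 0 < y) :
    |(∫ z in (0.5 : ℝ)..0.504, (gWeight Λ (P ^ z / y) - gWeight Λ (P ^ (0.5 : ℝ) / y))) -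
        ((∫ z in (0.5 : ℝ)..0.504, (Ioi (Real.log y / Real.log P)).indicator (fun _ => (1 : ℝ)) z) -
          0.004 * (if y < P ^ (0.5 : ℝ) then 1 else 0))| ≤
      (∫ z in (0.5 : ℝ)..0.504, (1 / 2) * rexp (-Λ * (z * Real.log P - Real.log y) ^ 2)) +
        0.004 * ((1 / 2) * rexp (-Λ * (0.5 * Real.log P - Real.log y) ^ 2)) := by
  have hP0 : 0 < P := by linarith
  have hle : (0.5 : ℝ) ≤ 0.504 := by norm_num
  set u : ℝ := Real.log y / Real.log P with hu
  set F : ℝ → ℝ := fun z => gWeight Λ (P ^ z / y) - (Ioi u).indicator (fun _ => (1 : ℝ)) z with hF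
  set c : ℝ := gWeight Λ (P ^ (0.5 : ℝ) / y) - (if y < P ^ (0.5 : ℝ) then 1 else 0) with hc
  set γ : ℝ → ℝ := fun z => (1 / 2) * rexp (-Λ * (z * Real.log P - Real.log y) ^ 2) with hγ
  -- pointwise bounds from (4.2)/(4.3)
  have hFle : ∀ z, |F z| ≤ γ z := by
    intro z
    have hx : 0 < P ^ z / y := div_pos (Real.rpow_pos_of_pos hP0 z) hy
    have hind : (Ioi u).indicator (fun _ => (1 : ℝ)) z = if 1 < P ^ z / y then 1 else 0 := by
      by_cases h : 1 < P ^ z / y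
      · rw [if_pos h, Set.indicator_of_mem (show z ∈ Ioi u from (one_lt_rpow_div_iff hP hy).mp h)]
      · rw [if_neg h, Set.indicator_of_notMem
          (show z ∉ Ioi u from fun hz => h ((one_lt_rpow_div_iff hP hy).mpr hz))]
    simp only [hF, hγ, hind]
    have := abs_gWeight_sub_indicator_le hΛ hx
    rwa [log_rpow_div hP0 hy] at this
  have hcle : |c| ≤ (1 / 2) * rexp (-Λ * (0.5 * Real.log P - Real.log y) ^ 2) := by
    have hx : 0 < P ^ (0.5 : ℝ) / y := div_pos (Real.rpow_pos_of_pos hP0 _) hy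
    have hind : (if y < P ^ (0.5 : ℝ) then (1 : ℝ) else 0) = if 1 < P ^ (0.5 : ℝ) / y then 1 else 0 := by
      by_cases h : y < P ^ (0.5 : ℝ)
      · rw [if_pos h, if_pos ((one_lt_div hy).mpr h)]
      · rw [if_neg h, if_neg (fun h' => h ((one_lt_div hy).mp h'))]
    simp only [hc, hind]
    have := abs_gWeight_sub_indicator_le hΛ hx
    rwa [log_rpow_div hP0 hy] at this
  -- integrability on `[0.5, 0.504]`
  have hg_int : IntervalIntegrable (fun z : ℝ => gWeight Λ (P ^ z / y)) volume 0.5 0.504 := by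
    have hmono : Monotone fun z : ℝ => gWeight Λ (P ^ z / y) := fun a b hab =>
      gWeight_mono hΛ (div_pos (Real.rpow_pos_of_pos hP0 a) hy)
        (div_le_div_of_nonneg_right (Real.rpow_le_rpow_of_exponent_le hP.le hab) hy.le)
    exact hmono.intervalIntegrable
  have hind_int : IntervalIntegrable (fun z : ℝ => (Ioi u).indicator (fun _ => (1 : ℝ)) z)
      volume 0.5 0.504 := by
    have hmono : Monotone fun z : ℝ => (Ioi u).indicator (fun _ => (1 : ℝ)) z := by
      intro a b hab
      dsimp only
      by_cases ha : a ∈ Ioi u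
      · have hb : b ∈ Ioi u := lt_of_lt_of_le ha hab
        simp [Set.indicator_of_mem ha, Set.indicator_of_mem hb]
      · rw [Set.indicator_of_notMem ha]
        exact Set.indicator_nonneg (fun _ _ => zero_le_one) _
    exact hmono.intervalIntegrable
  have hγ_int : IntervalIntegrable γ volume 0.5 0.504 := by
    apply Continuous.intervalIntegrable
    simp only [hγ]
    fun_prop
  -- rewrite the left side as `∫ F − 0.004·c`
  have hrew : (∫ z in (0.5 : ℝ)..0.504, (gWeight Λ (P ^ z / y) - gWeight Λ (P ^ (0.5 : ℝ) / y))) -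
      ((∫ z in (0.5 : ℝ)..0.504, (Ioi u).indicator (fun _ => (1 : ℝ)) z) -
        0.004 * (if y < P ^ (0.5 : ℝ) then 1 else 0)) =
      (∫ z in (0.5 : ℝ)..0.504, F z) - 0.004 * c := by
    rw [intervalIntegral.integral_sub hg_int intervalIntegrable_const, intervalIntegral.integral_const,
      smul_eq_mul, hF, intervalIntegral.integral_sub hg_int hind_int, hc]
    ring
  rw [hrew]
  have h1 : |∫ z in (0.5 : ℝ)..0.504, F z| ≤ ∫ z in (0.5 : ℝ)..0.504, γ z := by
    have := intervalIntegral.norm_integral_le_of_norm_le hle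
      (Filter.Eventually.of_forall fun z _ => by rw [Real.norm_eq_abs]; exact hFle z) hγ_int
    simpa only [Real.norm_eq_abs] using this
  calc |(∫ z in (0.5 : ℝ)..0.504, F z) - 0.004 * c|
      ≤ |∫ z in (0.5 : ℝ)..0.504, F z| + |0.004 * c| := abs_sub _ _
    _ ≤ (∫ z in (0.5 : ℝ)..0.504, γ z) + 0.004 * ((1 / 2) * rexp (-Λ * (0.5 * Real.log P - Real.log y) ^ 2)) := by
        rw [abs_mul, abs_of_pos (by norm_num : (0 : ℝ) < 0.004)]
        gcongr

/-! ## The Gaussian in `z`: a uniform bound and decay beyond the support -/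

/-- `∫_{0.5}^{0.504} ½e^{−Λ(zL − c)²}dz ≤ ½√(π/Λ)/L` for `Λ, L > 0` (extend to `ℝ`, substitute `w = zL − c`):
the `z`-averaged transition of the weight at `y = P^z` (the source's "+ O(α₁)" of the display after (B.3)).
[cite: Zhang2022LandauSiegel, App. B p.108 (proof of (B.3))] -/
theorem integral_gauss_transition_le {Λ L : ℝ} (hΛ : 0 < Λ) (hL : 0 < L) (c : ℝ) :
    ∫ z in (0.5 : ℝ)..0.504, (1 / 2) * rexp (-Λ * (z * L - c) ^ 2) ≤
      (1 / 2) * Real.sqrt (π / Λ) / L := by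
  have hle : (0.5 : ℝ) ≤ 0.504 := by norm_num
  set f : ℝ → ℝ := fun z => (1 / 2) * rexp (-Λ * (z * L - c) ^ 2) with hf
  have hf0 : ∀ z, 0 ≤ f z := fun z => by positivity
  -- the whole-line integral, by the substitution `w = L z` and translation
  have hgauss : ∫ w : ℝ, rexp (-Λ * (w - c) ^ 2) = Real.sqrt (π / Λ) := by
    have h := integral_sub_right_eq_self (μ := (volume : Measure ℝ)) (fun w : ℝ => rexp (-Λ * w ^ 2)) c
    rw [h]
    exact integral_gaussian Λ
  have hint_full : Integrable (fun w : ℝ => rexp (-Λ * (w - c) ^ 2)) := by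
    have h : Integrable (fun w : ℝ => rexp (-Λ * w ^ 2)) := integrable_exp_neg_mul_sq hΛ
    exact h.comp_sub_right c
  have hscale : ∫ z : ℝ, rexp (-Λ * (z * L - c) ^ 2) = (1 / L) * Real.sqrt (π / Λ) := by
    have h := Measure.integral_comp_mul_left (fun w : ℝ => rexp (-Λ * (w - c) ^ 2)) L
    simp only [smul_eq_mul] at h
    have : (fun z : ℝ => rexp (-Λ * (z * L - c) ^ 2)) = fun z : ℝ => rexp (-Λ * (L * z - c) ^ 2) := by
      funext z; rw [mul_comm z L]
    rw [this, h, hgauss, abs_inv, abs_of_pos hL, one_div]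
  have hint_scaled : Integrable (fun z : ℝ => rexp (-Λ * (z * L - c) ^ 2)) := by
    have h := hint_full.comp_mul_left' hL.ne'
    have : (fun z : ℝ => rexp (-Λ * (z * L - c) ^ 2)) = fun z : ℝ => rexp (-Λ * (L * z - c) ^ 2) := by
      funext z; rw [mul_comm z L]
    rw [this]; exact h
  have hintf : Integrable f := hint_scaled.const_mul _
  calc ∫ z in (0.5 : ℝ)..0.504, f z = ∫ z in Ioc (0.5 : ℝ) 0.504, f z := intervalIntegral.integral_of_le hle
    _ ≤ ∫ z : ℝ, f z := setIntegral_le_integral hintf (Filter.Eventually.of_forall hf0)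
    _ = (1 / 2) * Real.sqrt (π / Λ) / L := by
        simp only [hf]
        rw [integral_const_mul, hscale]
        ring

/-- Beyond the support: if `y > 0`, `log y ≥ L ≥ 1`, `Λ ≥ 9` and `z ≤ 0.504`, then
`½e^{−Λ(zL − log y)²} ≤ ½y⁻²` (`log y − zL ≥ 0.496 log y`): the terms `l₁l ≥ P` of the smoothed series
of the display after (B.3). [cite: Zhang2022LandauSiegel, App. B p.108 (proof of (B.3))] -/
theorem gauss_transition_decay {Λ L y z : ℝ} (hΛ : 9 ≤ Λ) (hL : 1 ≤ L) (hy0 : 0 < y)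
    (hy : L ≤ Real.log y) (hz : z ≤ 0.504) :
    (1 / 2) * rexp (-Λ * (z * L - Real.log y) ^ 2) ≤ (1 / 2) * y ^ (-2 : ℝ) := by
  have hlogy : 1 ≤ Real.log y := le_trans hL hy
  have hgap : 0.496 * Real.log y ≤ Real.log y - z * L := by
    have : z * L ≤ 0.504 * Real.log y := by
      calc z * L ≤ 0.504 * L := mul_le_mul_of_nonneg_right hz (by linarith)
        _ ≤ 0.504 * Real.log y := mul_le_mul_of_nonneg_left hy (by norm_num)
    linarith
  have hsq : (0.496 * Real.log y) ^ 2 ≤ (z * L - Real.log y) ^ 2 := by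
    rw [show (z * L - Real.log y) ^ 2 = (Real.log y - z * L) ^ 2 by ring]
    exact pow_le_pow_left₀ (by positivity) hgap 2
  have hexp : -Λ * (z * L - Real.log y) ^ 2 ≤ -2 * Real.log y := by
    have h1 : Λ * (0.496 * Real.log y) ^ 2 ≤ Λ * (z * L - Real.log y) ^ 2 :=
      mul_le_mul_of_nonneg_left hsq (by linarith)
    have h2 : 2 * Real.log y ≤ Λ * (0.496 * Real.log y) ^ 2 := by nlinarith
    linarith
  rw [Real.rpow_def_of_pos hy0, show Real.log y * (-2 : ℝ) = -2 * Real.log y by ring]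
  exact mul_le_mul_of_nonneg_left (Real.exp_le_exp.mpr hexp) (by norm_num)

end Literature.NumberTheory.LFunctions.Zhang2022.AppendixBVarrho
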